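import Summits.QuantumFields.YangMills.Theorems.FlatTubeReductionBOAssemblyRateD
import Summits.QuantumFields.YangMills.Theorems.FlatTubeReductionDressedOneOrbitRate
import Summits.QuantumFields.YangMills.Theorems.FlatTubeReductionRateTwoZonePow
import HarnessLib

/-!
# `BORateBricksCore`: the rate-grade Born–Oppenheimer brick list on a RATE CORE — `BORateBricksD` minus the dressed one-site no-intruder `hDS`, which is DISCHARGED from the
# one-site sub-target (EM) by `dressedOneOrbitRate_of_eigenMoments`; and the CORE RATE of skeleton «ratepack-v2» from such bricks
# (route `FlatTubeReduction`, crux K1 `NearFlatRatioLaw` stmt-QuantumFields-24720; seat `ym-line-ftr-p1` g10; R2b1 RECORD rung — no summit statement is proved here)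

The registered stub `stub_coreRateOfEM` of «ratepack-v2» (`Cruxes/NearFlatRatioLaw/Lines/ratepack_v2.lean`) is `(EM) → CORE RATE at k = 1 on {∃z, orbitDist(τ_zU) < β^{-1/6}}`.  THIS FILE
reduces it to ONE TYPED INSTANCE — `∃ M ≥ 2, ∀ L ≥ 2, BORateBricksCore L (recordChi L (1/6) 43 M) (powScale (1/6))` — i.e. to the fibre bricks (B-N), (B-T)-rate, (B-ST), (B-OD)-rate
and `hTop` with ADAPTED fibres on the `β^{-1/6}` core, for a dressed weight `W` that is physical (gauge AND twist invariant), `0 ≤ W ≤ C_W`, with the TWO-SIDED vacuum behaviour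
`|W² − 1| ≤ κ_W·orbitDist²` on the slow window `{orbitDist < δ₁ β}` and `κ_W δ₁² ≤ A λ_b(L³β)` eventually (true for the record window `δ₁ = 14β^{-1/6}/|Site|`):
* `BORateBricksCore L χ δ` (structure);
* ★★ `BORateBricksCore.toD` — `OneSiteEigenMoments → BORateBricksCore L χ δ → BORateBricksD L χ δ` (`hDS` at every level from `dressedOneOrbitRate_of_eigenMoments`, reindexed
  from the one-site coupling `B` to `β = B/L³`);
* ★★★ `coreRate_of_bricksCore` — `OneSiteEigenMoments → (∀ L ≥ 2, BORateBricksCore L (recordChi L (1/6) 43 M) (powScale (1/6))) → CORE RATE at every level k` (`softTubeBORatePackageOn_of_rateBricksD`,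
  `softTubeAdmissible_recordChi'` at `s = 1/6`, `innerRateAt_of_ratePackage`); ★★★★ `nearFlatRatioLaw_of_bricksCore_shell` — K1 ⟸ (EM) + that instance + lane A's SHELL.
HONEST FRAMING: the brick instance and (EM) are OPEN fixed-lattice semiclassics (pooled with RED lane A's C4-CORE pens and crux ONE's one-site machinery); this file is assembly algebra;
femto rung R2b1 (RECORD label); not infinite volume, not a gap, not Clay.  One new `structure`, no named facts, no `sorry`.
-/

set_option autoImplicit false

noncomputable section

open MeasureTheory Filter Topology Real
open scoped BigOperators
open Literature.MathematicalPhysics.QuantumFieldTheory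
open Literature.MathematicalPhysics.QuantumLattice

namespace Summit.QuantumFields.YangMills.Theorems.FemtoTransferGap.RateTube

open Summit.QuantumFields.YangMills.Theorems.FemtoTransferGap
open Summit.QuantumFields.YangMills.Theorems.FemtoTransferGap.TwoLattice.Avg
open Summit.QuantumFields.YangMills.Theorems.FemtoTransferGap.TwoLattice.ConstTube
open Summit.QuantumFields.YangMills.Theorems.FemtoTransferGap.TwoLattice.Stiff (LinkSpace)
open Summit.QuantumFields.YangMills.Theorems.FemtoCutoffLadder

variable (L : ℕ) [NeZero L]

/-! ## §1 The brick list on a rate core -/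

/-- **THE RATE-GRADE BORN–OPPENHEIMER BRICK LIST ON A RATE CORE** for a weight family `χ` and test radius `δ`: `BORateBricksD` (p656759) WITHOUT the dressed one-site no-intruder
`hDS` (discharged from (EM) by `toD`), and WITH the dressed weight PHYSICAL (gauge and twist invariant), `0 ≤ W ≤ C_W`, two-sided `|W² − 1| ≤ κ_W·orbitDist²` on the slow window
`{orbitDist < δ₁ β}`, which is a rate core: `κ_W δ₁² ≤ A λ_b(L³β)` eventually.  Remaining analytic fields: `hTop`, `hN`, `hT` (rate, dressed), `hST`, `hOD` (rate).
[cite: Luscher1983, §3] [cite: SjostrandZworski2007, §2] -/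
structure BORateBricksCore (χ : ℝ → GaugeConfig 3 L SU2 → ℝ) (δ : ℝ → ℝ) where
  /-- ADAPTED fibre profile `Ω β u v` (equivariant under global colour rotations) -/
  Ω : ℝ → GaugeConfig 3 1 SU2 → LinkSpace L → ℝ
  /-- DRESSED one-site weight `W β u` (`W² = λ_fib(u)/λ_fib(1)`: adapted-fibre zero-point energy + FP ratio; `> 1` off the vacuum for `L ≥ 3`), bounded measurable -/
  W : ℝ → GaugeConfig 3 1 SU2 → ℝ
  /-- slow window -/
  𝒰 : ℝ → Set (GaugeConfig 3 1 SU2)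
  /-- fibre energy factor, fibre mass, relative error, off-diagonal size, lower bound of `χ` on its support -/
  σ : ℝ → ℝ
  γ : ℝ → ℝ
  κ : ℝ → ℝ
  b : ℝ → ℝ
  c : ℝ → ℝ
  /-- stiff gap, one-site window radius, BO support radius, copy margin -/
  θ₀ : ℝ
  δ₁ : ℝ → ℝ
  δ₂ : ℝ → ℝ
  m : ℝ
  -- structural hypotheses
  hχm : ∀ β, Measurable (χ β)
  hχ1 : ∀ β U, |χ β U| ≤ 1
  hχ0 : ∀ β U, 0 ≤ χ β U
  hc : ∀ β, 0 < c β ∧ ∀ U, χ β U ≠ 0 → c β ≤ χ β U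
  hwm : ∀ β, Measurable (softWeight (χ β))
  hwb : ∀ β, ∃ Cw : ℝ, ∀ U, |softWeight (χ β) U| ≤ Cw
  hw0 : ∀ β U, 0 ≤ softWeight (χ β) U
  hwinv : ∀ β (g : SU2) (U : GaugeConfig 3 L SU2), softWeight (χ β) (gaugeTransform (fun _ : Site 3 L => g) U) = softWeight (χ β) U
  hΩm : ∀ β, Measurable (Function.uncurry (Ω β))
  hΩ1 : ∀ β u x, |Ω β u x| ≤ 1
  hΩinv : ∀ β (g : SU2) (u : GaugeConfig 3 1 SU2) (v : LinkSpace L), Ω β (gaugeTransform (fun _ : Site 3 1 => g) u) (adL L g v) = Ω β u v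
  /-- the dressed weight is PHYSICAL (bounded measurable, gauge AND twist invariant), nonnegative, uniformly bounded -/
  hWphys : ∀ β, IsPhys (W β)
  hW0 : ∀ β u, 0 ≤ W β u
  CW : ℝ
  hWbU : ∀ β u, |W β u| ≤ CW
  /-- TWO-SIDED vacuum behaviour of the dressed weight on the slow window: `|W² − 1| ≤ κ_W·orbitDist²` (any sign), and the window is a rate CORE: `κ_W δ₁² ≤ A λ_b(L³β)` -/
  κW : ℝ
  A : ℝ
  hκW : 0 ≤ κW
  hA : 0 ≤ A
  hWsq : ∀ β u, orbitDist u < δ₁ β → |W β u ^ 2 - 1| ≤ κW * orbitDist u ^ 2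
  hδ₁win : ∃ β1 : ℝ, ∀ β : ℝ, β1 ≤ β → 0 < δ₁ β ∧ δ₁ β ≤ 1 / 2 ∧ κW * δ₁ β ^ 2 ≤ A * bareLambda ((L : ℝ) ^ 3 * β)
  h𝒰m : ∀ β, MeasurableSet (𝒰 β)
  h𝒰inv : ∀ β (g : SU2) (u : GaugeConfig 3 1 SU2), gaugeTransform (fun _ : Site 3 1 => g) u ∈ 𝒰 β ↔ u ∈ 𝒰 β
  h𝒰δ₁ : ∀ β, ∀ u ∈ 𝒰 β, orbitDist u < δ₁ β
  hδ₁ : ∀ᶠ β in atTop, δ₁ β ≤ 1 / 2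
  htube : ∀ᶠ β in atTop, ∀ U, χ β U ≠ 0 → U ∈ orthoTubeSet L
  hshadow : ∀ᶠ β in atTop, ∀ U, χ β U ≠ 0 → orbitDist U < δ β → slowMean L U ∈ 𝒰 β
  hbo : ∀ᶠ β in atTop, ∀ (φ : GaugeConfig 3 1 SU2 → ℝ) (U : GaugeConfig 3 L SU2), (∀ u, φ u ≠ 0 → u ∈ 𝒰 β) → boFunAd L φ (Ω β) U ≠ 0 → χ β U ≠ 0 ∧ orbitDist U < δ₂ β
  hm : 0 ≤ m
  hm0 : 0 < m
  hδ₂ : ∀ᶠ β in atTop, (L : ℝ) * (δ₂ β + m) < 2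
  hσ : ∀ β, 0 < σ β
  hγ : ∀ β, 0 < γ β
  hκ : ∀ β, 0 ≤ κ β
  hb : ∀ β, 0 ≤ b β
  hθ₀ : 0 < θ₀ ∧ θ₀ ≤ 1
  hκ_small : ∃ a : ℝ, ∀ᶠ β in atTop, κ β ≤ a * bareLambda ((L : ℝ) ^ 3 * β) ^ 2
  hb_small : ∃ a : ℝ, ∀ᶠ β in atTop, b β ^ 2 ≤ a * bareLambda ((L : ℝ) ^ 3 * β) ^ 2
  -- the analytic bricks (RATE grade: `κ, b² = O(λ_b²)`; DRESSED one-site form `⟨φW, K_BφW⟩`)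
  hTop : ∃ C'' : ℝ, ∀ᶠ β in atTop, ∃ φ₀ : GaugeConfig 3 1 SU2 → ℝ, Measurable φ₀ ∧ (∃ C : ℝ, ∀ u, |φ₀ u| ≤ C) ∧
    (∀ (g : Site 3 1 → SU2) (u : GaugeConfig 3 1 SU2), φ₀ (gaugeTransform g u) = φ₀ u) ∧ (∀ u, φ₀ u ≠ 0 → u ∈ 𝒰 β) ∧ 0 < l2 φ₀ φ₀ ∧
    Real.exp (-(C'' * bareLambda ((L : ℝ) ^ 3 * β) ^ 2)) * levelValue su2Rep 1 ((L : ℝ) ^ 3 * β) 0 * l2 φ₀ φ₀ ≤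
      qform su2Rep ((L : ℝ) ^ 3 * β) (fun u => φ₀ u * W β u) (fun u => φ₀ u * W β u)
  hN : ∀ᶠ β in atTop, ∀ u ∈ 𝒰 β, |fibreMassAd L (softWeight (χ β)) (Ω β) u - γ β| ≤ κ β * γ β
  hT : ∀ᶠ β in atTop, ∀ φ : GaugeConfig 3 1 SU2 → ℝ, Measurable φ → (∃ C : ℝ, ∀ u, |φ u| ≤ C) →
    (∀ (g : Site 3 1 → SU2) (u : GaugeConfig 3 1 SU2), φ (gaugeTransform g u) = φ u) → (∀ u, φ u ≠ 0 → u ∈ 𝒰 β) →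
    |tubeForm β (boFunAd L φ (Ω β)) - σ β * γ β * qform su2Rep ((L : ℝ) ^ 3 * β) (fun u => φ u * W β u) (fun u => φ u * W β u)| ≤
      κ β * (σ β * γ β) * (qform su2Rep ((L : ℝ) ^ 3 * β) (fun u => φ u * W β u) (fun u => φ u * W β u) + levelValue su2Rep 1 ((L : ℝ) ^ 3 * β) 0 * l2 φ φ)
  hST : ∀ᶠ β in atTop, ∀ v : GaugeConfig 3 L SU2 → ℝ, Measurable v → (∃ C : ℝ, ∀ U, |v U| ≤ C) → (∀ U, v U ≠ 0 → χ β U ≠ 0) →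
    (∀ u, fibreInnerAd L (softWeight (χ β)) (Ω β) v u = 0) →
    tubeForm β v ≤ (1 - θ₀) * (σ β * levelValue su2Rep 1 ((L : ℝ) ^ 3 * β) 0) * tubeNormSq (softWeight (χ β)) v
  hOD : ∀ᶠ β in atTop, ∀ (φ : GaugeConfig 3 1 SU2 → ℝ) (v : GaugeConfig 3 L SU2 → ℝ), Measurable φ → (∃ C : ℝ, ∀ u, |φ u| ≤ C) → (∀ u, φ u ≠ 0 → u ∈ 𝒰 β) →
    Measurable v → (∃ C : ℝ, ∀ U, |v U| ≤ C) → (∀ U, v U ≠ 0 → χ β U ≠ 0) → (∀ u, fibreInnerAd L (softWeight (χ β)) (Ω β) v u = 0) →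
    |tubeCross β (boFunAd L φ (Ω β)) v| ≤ b β * (σ β * levelValue su2Rep 1 ((L : ℝ) ^ 3 * β) 0) *
        Real.sqrt (tubeNormSq (softWeight (χ β)) (boFunAd L φ (Ω β))) * Real.sqrt (tubeNormSq (softWeight (χ β)) v) ∧
    |tubeCross β v (boFunAd L φ (Ω β))| ≤ b β * (σ β * levelValue su2Rep 1 ((L : ℝ) ^ 3 * β) 0) *
        Real.sqrt (tubeNormSq (softWeight (χ β)) (boFunAd L φ (Ω β))) * Real.sqrt (tubeNormSq (softWeight (χ β)) v)


/-! ## §2 ★★ (EM) discharges `hDS`: core bricks become dressed bricks -/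

variable {L}

set_option maxHeartbeats 400000 in
/-- ★★ **`BORateBricksCore → BORateBricksD` given (EM)**: the dressed one-site no-intruder `hDS` at every level from `dressedOneOrbitRate_of_eigenMoments`, with the one-site
coupling `B = L³β` (weights and window reindexed by `β = B/L³`). [cite: Luscher1983, §3] -/
def BORateBricksCore.toD (hEM : OneSiteEigenMoments) {χ : ℝ → GaugeConfig 3 L SU2 → ℝ} {δ : ℝ → ℝ} (K : BORateBricksCore L χ δ) : BORateBricksD L χ δ :=
  have hL3 : (0 : ℝ) < (L : ℝ) ^ 3 := pow_pos (by exact_mod_cast Nat.pos_of_ne_zero (NeZero.ne L)) 3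
  have hDS : ∀ k : ℕ, ∃ CD : ℝ, ∀ᶠ β in atTop, ∀ G : Fin (k + 1) → (GaugeConfig 3 1 SU2 → ℝ), (∀ i, Measurable (G i)) → (∀ i, ∃ C : ℝ, ∀ u, |G i u| ≤ C) →
      (∀ i (g : Site 3 1 → SU2) (u : GaugeConfig 3 1 SU2), G i (gaugeTransform g u) = G i u) → (∀ i u, G i u ≠ 0 → orbitDist u < K.δ₁ β) →
      (∀ a : Fin (k + 1) → ℝ, a ≠ 0 → 0 < l2 (fun u => (∑ i, a i * G i u) * K.W β u) (fun u => (∑ i, a i * G i u) * K.W β u)) →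
        ∃ a : Fin (k + 1) → ℝ, a ≠ 0 ∧
          qform su2Rep ((L : ℝ) ^ 3 * β) (fun u => (∑ i, a i * G i u) * K.W β u) (fun u => (∑ i, a i * G i u) * K.W β u) * levelValue su2Rep 1 ((L : ℝ) ^ 3 * β) 0 ≤
            Real.exp (CD * bareLambda ((L : ℝ) ^ 3 * β) ^ 2) * levelValue su2Rep 1 ((L : ℝ) ^ 3 * β) k * levelValue su2Rep 1 ((L : ℝ) ^ 3 * β) 0 *
              l2 (fun u => ∑ i, a i * G i u) (fun u => ∑ i, a i * G i u) := by
    intro k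
    -- reindex by the one-site coupling `B = L³β`
    obtain ⟨β1, hwin⟩ := K.hδ₁win
    have hδ' : ∃ B1 : ℝ, ∀ B : ℝ, B1 ≤ B → 0 < K.δ₁ (B / (L : ℝ) ^ 3) ∧ K.δ₁ (B / (L : ℝ) ^ 3) ≤ 1 / 2 ∧
        K.κW * K.δ₁ (B / (L : ℝ) ^ 3) ^ 2 ≤ K.A * bareLambda B := by
      refine ⟨(L : ℝ) ^ 3 * max β1 0, fun B hB => ?_⟩
      have hb : β1 ≤ B / (L : ℝ) ^ 3 := by
        rw [le_div_iff₀ hL3]; nlinarith [le_max_left β1 0, le_max_right β1 0]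
      obtain ⟨h1, h2, h3⟩ := hwin _ hb
      have e : (L : ℝ) ^ 3 * (B / (L : ℝ) ^ 3) = B := by rw [← mul_div_assoc, mul_comm ((L : ℝ) ^ 3) B, mul_div_assoc, div_self hL3.ne', mul_one]
      rw [e] at h3
      exact ⟨h1, h2, h3⟩
    obtain ⟨C, B₀, h⟩ := dressedOneOrbitRate_of_eigenMoments hEM k (δ := fun B => K.δ₁ (B / (L : ℝ) ^ 3)) (W := fun B => K.W (B / (L : ℝ) ^ 3))
      K.hκW K.hA (fun B => K.hWphys _) (fun B u => K.hWbU _ u) (fun B u => K.hW0 _ u) (fun B u hu => K.hWsq _ u hu) hδ'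
    refine ⟨C, ?_⟩
    filter_upwards [Filter.eventually_ge_atTop (B₀ / (L : ℝ) ^ 3)] with β hβ
    have hB : B₀ ≤ (L : ℝ) ^ 3 * β := by rw [div_le_iff₀ hL3] at hβ; linarith
    have e : (L : ℝ) ^ 3 * β / (L : ℝ) ^ 3 = β := by rw [mul_comm, mul_div_assoc, div_self hL3.ne', mul_one]
    have h' := h ((L : ℝ) ^ 3 * β) hB
    simp only [e] at h'
    intro G hGm hGb hGg hGs _
    exact h' G hGm hGb hGg hGs
  { Ω := K.Ω, W := K.W, 𝒰 := K.𝒰, σ := K.σ, γ := K.γ, κ := K.κ, b := K.b, c := K.c, θ₀ := K.θ₀, δ₁ := K.δ₁, δ₂ := K.δ₂, m := K.m,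
    hχm := K.hχm, hχ1 := K.hχ1, hχ0 := K.hχ0, hc := K.hc, hwm := K.hwm, hwb := K.hwb, hw0 := K.hw0, hwinv := K.hwinv,
    hΩm := K.hΩm, hΩ1 := K.hΩ1, hΩinv := K.hΩinv, hWm := fun β => (K.hWphys β).measurable, hWb := fun β => ⟨K.CW, K.hWbU β⟩,
    h𝒰m := K.h𝒰m, h𝒰inv := K.h𝒰inv, h𝒰δ₁ := K.h𝒰δ₁, hδ₁ := K.hδ₁, htube := K.htube, hshadow := K.hshadow, hbo := K.hbo, hm := K.hm, hm0 := K.hm0, hδ₂ := K.hδ₂,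
    hσ := K.hσ, hγ := K.hγ, hκ := K.hκ, hb := K.hb, hθ₀ := K.hθ₀, hκ_small := K.hκ_small, hb_small := K.hb_small,
    hDS := hDS, hTop := K.hTop, hN := K.hN, hT := K.hT, hST := K.hST, hOD := K.hOD }

/-! ## §3 ★★★ The CORE RATE of «ratepack-v2» from core bricks on the record `β^{-1/6}` window, and K1 -/

/-- `β^{−1/6} ≤ 1/(2L)` eventually. [folklore] -/
theorem powScale_sixth_eventually_le : ∃ β1 : ℝ, ∀ β : ℝ, β1 ≤ β → powScale (1 / 6) β ≤ 1 / (2 * L) := by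
  have hL : (0 : ℝ) < L := by exact_mod_cast Nat.pos_of_ne_zero (NeZero.ne L)
  exact powScale_eventually_le (by norm_num) (by positivity)

/-- ★★★ **CORE RATE at every level from core bricks + (EM)** for the record core weight `recordChi L (1/6) 43 M` (`M ≥ 2`), test support `{orbitDist < β^{−1/6}}`:
`softTubeBORatePackageOn_of_rateBricksD ∘ toD`, `softTubeAdmissible_recordChi'` at `s = 1/6`, `innerRateAt_of_ratePackage`. [cite: Luscher1983, §3] -/
theorem coreRate_of_bricksCore (hEM : OneSiteEigenMoments) {M : ℝ} (hM : 2 ≤ M) (K : BORateBricksCore L (recordChi L (1 / 6) 43 M) (powScale (1 / 6))) (k : ℕ) :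
    ∃ C βI : ℝ, ∀ β : ℝ, βI ≤ β →
      ∀ F : Fin (k + 1) → (GaugeConfig 3 L SU2 → ℝ), (∀ i, IsPhys (F i)) →
        (∀ i U, F i U ≠ 0 → ∃ z : Fin 3 → Bool, orbitDist (TT.twist3 z U) < powScale (1 / 6) β) →
        (∀ a : Fin (k + 1) → ℝ, a ≠ 0 → 0 < l2 (fun U => ∑ i, a i * F i U) (fun U => ∑ i, a i * F i U)) →
          ∃ a : Fin (k + 1) → ℝ, a ≠ 0 ∧
            qform su2Rep β (fun U => ∑ i, a i * F i U) (fun U => ∑ i, a i * F i U) * levelValue su2Rep 1 ((L : ℝ) ^ 3 * β) 0 ≤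
              Real.exp (C * bareLambda ((L : ℝ) ^ 3 * β) ^ 2) * levelValue su2Rep 1 ((L : ℝ) ^ 3 * β) k *
                levelValue su2Rep L β 0 * l2 (fun U => ∑ i, a i * F i U) (fun U => ∑ i, a i * F i U) :=
  innerRateAt_of_ratePackage (L := L) k (fun β => powScale_pos (1 / 6) β) powScale_sixth_eventually_le
    (softTubeAdmissible_recordChi' (1 / 6) 43 M (by norm_num) hM) (softTubeBORatePackageOn_of_rateBricksD (K.toD hEM))

/-- ★★★★ **K1 `NearFlatRatioLaw` ⟸ (EM) + core bricks on the `β^{-1/6}` window for every `L ≥ 2` + lane A's SHELL** — `nearFlatRatioLaw_of_coreRate_shell_pow` with the core rate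
at `k = 1`. [cite: Luscher1983, §3] -/
theorem nearFlatRatioLaw_of_bricksCore_shell (hEM : OneSiteEigenMoments) {M : ℝ} (hM : 2 ≤ M)
    (K : ∀ (L : ℕ) [NeZero L], 2 ≤ L → BORateBricksCore L (recordChi L (1 / 6) 43 M) (powScale (1 / 6)))
    (hshell : ∀ (L : ℕ) [NeZero L], 2 ≤ L → InnerShellGainAt L (powScale (1 / 6)) (powScale (1 / 40))) :
    Summit.QuantumFields.YangMills.Theses.FlatTubeReduction.NearFlatRatioLaw :=
  nearFlatRatioLaw_of_coreRate_shell_pow (fun L _ hL => coreRate_of_bricksCore hEM hM (K L hL) 1) hshell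

end Summit.QuantumFields.YangMills.Theorems.FemtoTransferGap.RateTube

end
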